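import Summits.QuantumFields.YangMills.Theorems.BalabanUVNodesN15KingModelFreePropagatorComparison

/-!
# BalabanUVNodes ∕ N15 — THE KING-MODEL RUNG (PART Ϻ-d): EUCLIDEAN CLUSTERING OF KING's CONTINUUM BLOCK TWO-POINT FUNCTION AT EVERY RATE `(1−ε)m`,
# AND THE ISOTROPIC EXACT CORRELATION LENGTH — `log S₂^{ℝ}(z) ∕ ‖z‖₂ → −m` along the cofinite filter of `ℤ^{d+1}`
# (Track A, DAG node N15 = NE2; FAN-OUT v1.1 §N15 s3 «KING-MODEL RUNG»; uses parts Ϻ-b∕Ϻ-c; count-neutral)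

HONEST FRAMING.  Count-neutral (cell `pub-ymgap`, seat `pub-ymgap-dag-n15-e` g35; `--supports stmt-QuantumFields-27366 --as helper` = K3⁸).  King's `A = 0`, `g = 0` model
([King1986] C. King, Commun. Math. Phys. **102** (1986) 649–677).  Parts Ϸ-r∕Ϸ-s proved the clustering of the continuum block two-point function of Theorem 2.1's
limit at the mass rate `m` in every COORDINATE direction and in the sup-norm (`|S₂^{ℝ}(z)| ≤ S₂^{ℝ}(e₀)e^{m}e^{−m‖z‖_∞}`), which in the Euclidean norm is only the rate
`m∕√(d+1)`; parts Ϸ-j∕Ϸ-t had the exact rate `e^{−m}` along lattice RAYS.  THIS FILE closes the Euclidean question: from part Ϻ-c's sandwich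
`C_m(R₊(z)) ≤ S₂^{ℝ}(z) ≤ C_m(R₋(z))` and the two elementary estimates on the proper-time form of the free propagator — UPPER: `tm² + R²∕4t ≥ mR` (AM–GM) splits
`e^{−tm²−R²∕4t} ≤ e^{−(1−ε)mR}·e^{−εtm²}e^{−εR₀²∕4t}` for `R ≥ R₀`, whence `C_m(R) ≤ e^{−(1−ε)mR}·C_{√ε m}(√ε R₀)`; LOWER: on the proper-time window `t ∈ (R∕2m, R∕2m+1]`,
`tm² + R²∕4t ≤ mR + m²`, whence `C_m(R) ≥ e^{−mR−m²}(4π(R∕2m+1))^{−(d+1)∕2}` — we get ★★★ `S₂^{ℝ}(z) ≤ K(ε,d,m)·e^{−(1−ε)m‖z‖₂}` for EVERY `0 < ε ≤ 1` and EVERY `z`, and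
★★★ `S₂^{ℝ}(z) ≥ e^{−m²}e^{−m(‖z‖₂+√(d+1))}(4π((‖z‖₂+√(d+1))∕2m+1))^{−(d+1)∕2}`; hence ★★★ `log S₂^{ℝ}(z)∕‖z‖₂ → −m` as `z → ∞` in `ℤ^{d+1}` (cofinite filter): the
correlation length of King's continuum block field is EXACTLY `1∕m`, ISOTROPICALLY.  (The polynomial prefactor `R^{−d∕2}` of the true asymptotics is not extracted; the
rate is.)  NOT Bałaban's objects; NOT a node discharge; nothing continuum-Yang–Mills ∕ `ℝ⁴` ∕ OS ∕ Clay — «m» is the free field's mass.  0 `sorry`, 0 def; standard axioms.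

WHAT THIS FILE PROVES (kernel).  §1 `mul_le_proper_time_action` (AM–GM), ★★ **`freePropRadial_le_exp_mul`**, `proper_time_window_action_le`, ★★ **`exp_mul_le_freePropRadial`**.
§2 ★★★ **`kingS2Inf_le_exp_mul_blockGap`**, ★★★ **`kingS2Inf_le_const_mul_exp_neg_norm`** (every `z`), ★★ **`exp_le_kingS2Inf`** (every `z`).  §3 `finite_norm_le`,
★ `tendsto_euclidNorm_cofinite`, `tendsto_log_affine_div`, ★★★ **`tendsto_log_kingS2Inf_div_norm`**.

HONEST SCOPE.  King's free model, `m² > 0`, every `d`; constants are explicit but not optimised.  N15 untouched; counts unmoved.  Locators (use): [King1986] Thm 2.1 (2.22) p.654,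
Thm 3.3 (3.6) p.655, (4.5) p.670.
-/

noncomputable section

open scoped BigOperators Topology
open Filter MeasureTheory Set Function

namespace Summit.QuantumFields.YangMills.BalabanUVNodes.N15KingModelRung.ProperTime

open Summit.QuantumFields.YangMills.BalabanUVNodes.N15KingModelRung.OptimalDecay

variable {d : ℕ}

/-! ## §1 Two elementary estimates on `C_m(R) = ∫₀^∞ e^{−tm²}k_t(R)dt` -/

/-- AM–GM in proper time: `√m²·R ≤ tm² + R²∕(4t)` (`t > 0`). [folklore] -/
theorem mul_le_proper_time_action {m2 t : ℝ} (hm : 0 ≤ m2) (ht : 0 < t) (R : ℝ) : Real.sqrt m2 * R ≤ t * m2 + R ^ 2 / (4 * t) := by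
  have hm' : Real.sqrt m2 ^ 2 = m2 := Real.sq_sqrt hm
  have h4 : 0 < 4 * t := by positivity
  have hR : 4 * t * (t * m2 + R ^ 2 / (4 * t)) = 4 * t ^ 2 * m2 + R ^ 2 := by
    field_simp
  have key : 4 * t * (Real.sqrt m2 * R) ≤ 4 * t * (t * m2 + R ^ 2 / (4 * t)) := by
    rw [hR]
    nlinarith [sq_nonneg (2 * t * Real.sqrt m2 - R), hm']
  exact le_of_mul_le_mul_left key h4

/-- ★★ **UPPER**: for `0 < ε ≤ 1`, `0 < R₀ ≤ R`: `C_m(R) ≤ e^{−(1−ε)√m²·R}·C_{εm²}(√ε·R₀)` (the rate `(1−ε)m` with an `R`-free constant). [folklore] -/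
theorem freePropRadial_le_exp_mul {m2 ε R₀ R : ℝ} (hm : 0 < m2) (hε0 : 0 < ε) (hε1 : ε ≤ 1) (hR₀ : 0 < R₀) (hR : R₀ ≤ R) :
    freePropRadial d m2 R ≤ Real.exp (-((1 - ε) * Real.sqrt m2 * R)) * freePropRadial d (ε * m2) (Real.sqrt ε * R₀) := by
  have hRpos : 0 < R := hR₀.trans_le hR
  have hεm : 0 < ε * m2 := mul_pos hε0 hm
  have hεR : 0 < Real.sqrt ε * R₀ := mul_pos (Real.sqrt_pos.mpr hε0) hR₀
  unfold freePropRadial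
  rw [← integral_const_mul]
  refine setIntegral_mono_on (integrableOn_exp_mul_heatRadial hm hRpos) ((integrableOn_exp_mul_heatRadial hεm hεR).const_mul _) measurableSet_Ioi fun t ht => ?_
  have ht : 0 < t := ht
  unfold heatRadial
  have hc : 0 ≤ ((Real.sqrt (4 * Real.pi * t))⁻¹) ^ (d + 1) := pow_nonneg (inv_nonneg.mpr (Real.sqrt_nonneg _)) _
  -- compare the exponents
  have hsq : (Real.sqrt ε * R₀) ^ 2 = ε * R₀ ^ 2 := by rw [mul_pow, Real.sq_sqrt hε0.le]
  have hexp : Real.exp (-(t * m2)) * Real.exp (-(R ^ 2 / (4 * t)))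
      ≤ Real.exp (-((1 - ε) * Real.sqrt m2 * R)) * (Real.exp (-(t * (ε * m2))) * Real.exp (-((Real.sqrt ε * R₀) ^ 2 / (4 * t)))) := by
    rw [← Real.exp_add, ← Real.exp_add, ← Real.exp_add, Real.exp_le_exp, hsq]
    have hamgm := mul_le_proper_time_action hm.le ht R
    have hR2 : R₀ ^ 2 ≤ R ^ 2 := pow_le_pow_left₀ hR₀.le hR 2
    have h4 : 0 < 4 * t := by positivity
    have hdiv : ε * R₀ ^ 2 / (4 * t) ≤ ε * R ^ 2 / (4 * t) := div_le_div_of_nonneg_right (mul_le_mul_of_nonneg_left hR2 hε0.le) h4.le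
    have h1ε : 0 ≤ 1 - ε := by linarith
    have key : (1 - ε) * (Real.sqrt m2 * R) ≤ (1 - ε) * (t * m2 + R ^ 2 / (4 * t)) := mul_le_mul_of_nonneg_left hamgm h1ε
    have hsplit : t * m2 + R ^ 2 / (4 * t) = (1 - ε) * (t * m2 + R ^ 2 / (4 * t)) + (t * (ε * m2) + ε * R ^ 2 / (4 * t)) := by ring
    linarith
  calc Real.exp (-(t * m2)) * (((Real.sqrt (4 * Real.pi * t))⁻¹) ^ (d + 1) * Real.exp (-(R ^ 2 / (4 * t))))
      = ((Real.sqrt (4 * Real.pi * t))⁻¹) ^ (d + 1) * (Real.exp (-(t * m2)) * Real.exp (-(R ^ 2 / (4 * t)))) := by ring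
    _ ≤ ((Real.sqrt (4 * Real.pi * t))⁻¹) ^ (d + 1)
          * (Real.exp (-((1 - ε) * Real.sqrt m2 * R)) * (Real.exp (-(t * (ε * m2))) * Real.exp (-((Real.sqrt ε * R₀) ^ 2 / (4 * t))))) :=
        mul_le_mul_of_nonneg_left hexp hc
    _ = Real.exp (-((1 - ε) * Real.sqrt m2 * R))
          * (Real.exp (-(t * (ε * m2))) * (((Real.sqrt (4 * Real.pi * t))⁻¹) ^ (d + 1) * Real.exp (-((Real.sqrt ε * R₀) ^ 2 / (4 * t))))) := by ring

/-- On the proper-time window `R∕(2√m²) < t ≤ R∕(2√m²) + 1` (`R ≥ 0`): `tm² + R²∕(4t) ≤ √m²·R + m²`. [folklore] -/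
theorem proper_time_window_action_le {m2 R t : ℝ} (hm : 0 < m2) (hR : 0 ≤ R) (ht1 : R / (2 * Real.sqrt m2) < t) (ht2 : t ≤ R / (2 * Real.sqrt m2) + 1) :
    t * m2 + R ^ 2 / (4 * t) ≤ Real.sqrt m2 * R + m2 := by
  have hm' : 0 < Real.sqrt m2 := Real.sqrt_pos.mpr hm
  have hsq : Real.sqrt m2 ^ 2 = m2 := Real.sq_sqrt hm.le
  have ht : 0 < t := lt_of_le_of_lt (by positivity) ht1
  -- `t m² ≤ (R/(2m) + 1) m² = mR/2 + m²`
  have hne : Real.sqrt m2 ≠ 0 := hm'.ne'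
  have h1 : t * m2 ≤ Real.sqrt m2 * R / 2 + m2 := by
    have := mul_le_mul_of_nonneg_right ht2 hm.le
    have e' : R / (2 * Real.sqrt m2) * m2 = Real.sqrt m2 * R / 2 := by
      calc R / (2 * Real.sqrt m2) * m2 = R / (2 * Real.sqrt m2) * (Real.sqrt m2 * Real.sqrt m2) := by rw [Real.mul_self_sqrt hm.le]
        _ = Real.sqrt m2 * R / 2 := by field_simp
    have e : (R / (2 * Real.sqrt m2) + 1) * m2 = Real.sqrt m2 * R / 2 + m2 := by rw [add_mul, one_mul, e']
    linarith
  -- `R²/(4t) ≤ R²/(4·R/(2m)) = mR/2` (for `R > 0`; trivial for `R = 0`)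
  have h2 : R ^ 2 / (4 * t) ≤ Real.sqrt m2 * R / 2 := by
    rcases hR.eq_or_lt with h0 | hRpos
    · rw [← h0]; simp
    · rw [div_le_iff₀ (by positivity)]
      have : R / (2 * Real.sqrt m2) * (4 * Real.sqrt m2) = 2 * R := by field_simp; ring
      nlinarith [mul_le_mul_of_nonneg_right ht1.le (by positivity : (0 : ℝ) ≤ 4 * Real.sqrt m2 * R)]
  linarith

/-- ★★ **LOWER**: for `R > 0`, `C_m(R) ≥ e^{−(√m²R + m²)}·(4π(R∕(2√m²)+1))^{−(d+1)∕2}` (the proper-time window of length one past `R∕2m`). [folklore] -/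
theorem exp_mul_le_freePropRadial {m2 R : ℝ} (hm : 0 < m2) (hR : 0 < R) :
    Real.exp (-(Real.sqrt m2 * R + m2)) * ((Real.sqrt (4 * Real.pi * (R / (2 * Real.sqrt m2) + 1)))⁻¹) ^ (d + 1) ≤ freePropRadial d m2 R := by
  have hm' : 0 < Real.sqrt m2 := Real.sqrt_pos.mpr hm
  set a : ℝ := R / (2 * Real.sqrt m2) with ha
  have ha0 : 0 ≤ a := by positivity
  set c : ℝ := Real.exp (-(Real.sqrt m2 * R + m2)) * ((Real.sqrt (4 * Real.pi * (a + 1)))⁻¹) ^ (d + 1) with hc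
  set f : ℝ → ℝ := fun t => Real.exp (-(t * m2)) * heatRadial d t R with hf
  have hfi : IntegrableOn f (Ioi (0 : ℝ)) := integrableOn_exp_mul_heatRadial hm hR
  have hsub : Ioc a (a + 1) ⊆ Ioi (0 : ℝ) := fun t ht => lt_of_le_of_lt ha0 ht.1
  -- on the window, `f ≥ c`
  have hwin : ∀ t ∈ Ioc a (a + 1), c ≤ f t := by
    intro t ht
    have ht0 : 0 < t := lt_of_le_of_lt ha0 ht.1
    have hact := proper_time_window_action_le hm hR.le ht.1 ht.2
    simp only [hc, hf, heatRadial]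
    have hsqrt : (Real.sqrt (4 * Real.pi * (a + 1)))⁻¹ ≤ (Real.sqrt (4 * Real.pi * t))⁻¹ := by
      refine inv_anti₀ (Real.sqrt_pos.mpr (by positivity)) (Real.sqrt_le_sqrt ?_)
      exact mul_le_mul_of_nonneg_left ht.2 (by positivity)
    have hpow : ((Real.sqrt (4 * Real.pi * (a + 1)))⁻¹) ^ (d + 1) ≤ ((Real.sqrt (4 * Real.pi * t))⁻¹) ^ (d + 1) :=
      pow_le_pow_left₀ (inv_nonneg.mpr (Real.sqrt_nonneg _)) hsqrt _
    have hexp : Real.exp (-(Real.sqrt m2 * R + m2)) ≤ Real.exp (-(t * m2)) * Real.exp (-(R ^ 2 / (4 * t))) := by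
      rw [← Real.exp_add, Real.exp_le_exp]
      linarith
    calc Real.exp (-(Real.sqrt m2 * R + m2)) * ((Real.sqrt (4 * Real.pi * (a + 1)))⁻¹) ^ (d + 1)
        ≤ (Real.exp (-(t * m2)) * Real.exp (-(R ^ 2 / (4 * t)))) * ((Real.sqrt (4 * Real.pi * t))⁻¹) ^ (d + 1) :=
          mul_le_mul hexp hpow (pow_nonneg (inv_nonneg.mpr (Real.sqrt_nonneg _)) _) (by positivity)
      _ = Real.exp (-(t * m2)) * (((Real.sqrt (4 * Real.pi * t))⁻¹) ^ (d + 1) * Real.exp (-(R ^ 2 / (4 * t)))) := by ring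
  have hvol : volume (Ioc a (a + 1)) = 1 := by rw [Real.volume_Ioc]; simp
  calc c = ∫ _ in Ioc a (a + 1), c := by rw [setIntegral_const]; simp [Measure.real, hvol]
    _ ≤ ∫ t in Ioc a (a + 1), f t :=
        setIntegral_mono_on (integrableOn_const (by rw [hvol]; exact ENNReal.one_ne_top)) (hfi.mono_set hsub) measurableSet_Ioc hwin
    _ ≤ ∫ t in Ioi (0 : ℝ), f t := by
        refine setIntegral_mono_set hfi ?_ (Eventually.of_forall hsub)
        filter_upwards [ae_restrict_mem measurableSet_Ioi] with t ht
        exact mul_nonneg (Real.exp_nonneg _) (heatRadial_nonneg _ _)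
    _ = freePropRadial d m2 R := rfl

/-! ## §2 Euclidean clustering of `S₂^{ℝ}` -/

/-- ★★★ **UPPER, via the block gap**: for `0 < ε ≤ 1`, `0 < R₀ ≤ R₋(z)`: `S₂^{ℝ}(z) ≤ e^{−(1−ε)√m²·R₋(z)}·C_{√εm}(√εR₀)`.
[cite: King1986, Thm 3.3 (3.6) p.655, Thm 2.1 (2.22) p.654] -/
theorem kingS2Inf_le_exp_mul_blockGap {m2 ε R₀ : ℝ} (hm : 0 < m2) (hε0 : 0 < ε) (hε1 : ε ≤ 1) (hR₀ : 0 < R₀) {z : Fin (d + 1) → ℤ} (hz : R₀ ≤ blockGap z) :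
    kingS2Inf m2 z ≤ Real.exp (-((1 - ε) * Real.sqrt m2 * blockGap z)) * freePropRadial d (ε * m2) (Real.sqrt ε * R₀) :=
  (kingS2Inf_le_freePropRadial hm (hR₀.trans_le hz)).trans (freePropRadial_le_exp_mul hm hε0 hε1 hR₀ hz)

/-- ★★★ **EUCLIDEAN CLUSTERING AT EVERY RATE `(1−ε)m`**: for `0 < ε ≤ 1` and EVERY `z ∈ ℤ^{d+1}`,
`S₂^{ℝ}(z) ≤ e^{(1−ε)√m²(1+√(d+1))}·(C_{√εm}(√ε) + m⁻²)·e^{−(1−ε)√m²·‖z‖₂}` (`‖z‖₂` the Euclidean norm; parts Ϸ-r∕Ϸ-s had the rate `m` in `‖·‖_∞` only).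
[cite: King1986, Thm 3.3 (3.6) p.655, Thm 2.1 (2.22)–(2.23) p.654] -/
theorem kingS2Inf_le_const_mul_exp_neg_norm {m2 ε : ℝ} (hm : 0 < m2) (hε0 : 0 < ε) (hε1 : ε ≤ 1) (z : Fin (d + 1) → ℤ) :
    kingS2Inf m2 z
      ≤ Real.exp ((1 - ε) * Real.sqrt m2 * (1 + Real.sqrt (d + 1))) * (freePropRadial d (ε * m2) (Real.sqrt ε) + m2⁻¹)
          * Real.exp (-((1 - ε) * Real.sqrt m2 * ‖WithLp.toLp 2 (fun μ => (z μ : ℝ))‖)) := by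
  set N : ℝ := ‖WithLp.toLp 2 (fun μ => (z μ : ℝ))‖ with hN
  set m : ℝ := Real.sqrt m2 with hmdef
  have hm' : 0 < m := Real.sqrt_pos.mpr hm
  have h1ε : 0 ≤ 1 - ε := by linarith
  have hC : 0 < freePropRadial d (ε * m2) (Real.sqrt ε) := freePropRadial_pos (mul_pos hε0 hm) (Real.sqrt_pos.mpr hε0)
  have hgap := norm_sub_le_blockGap z
  rw [← hN] at hgap
  rcases le_or_gt (1 + Real.sqrt (d + 1)) N with hbig | hsmall
  · -- separated blocks: `R₋(z) ≥ N − √(d+1) ≥ 1`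
    have hz : (1 : ℝ) ≤ blockGap z := by linarith
    have h := kingS2Inf_le_exp_mul_blockGap hm hε0 hε1 one_pos hz
    rw [mul_one] at h
    refine h.trans ?_
    have hexp : Real.exp (-((1 - ε) * m * blockGap z)) ≤ Real.exp ((1 - ε) * m * (1 + Real.sqrt (d + 1))) * Real.exp (-((1 - ε) * m * N)) := by
      rw [← Real.exp_add, Real.exp_le_exp]
      have := mul_le_mul_of_nonneg_left hgap (mul_nonneg h1ε hm'.le)
      nlinarith [mul_nonneg (mul_nonneg h1ε hm'.le) (zero_le_one : (0 : ℝ) ≤ 1)]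
    calc Real.exp (-((1 - ε) * m * blockGap z)) * freePropRadial d (ε * m2) (Real.sqrt ε)
        ≤ (Real.exp ((1 - ε) * m * (1 + Real.sqrt (d + 1))) * Real.exp (-((1 - ε) * m * N))) * freePropRadial d (ε * m2) (Real.sqrt ε) :=
          mul_le_mul_of_nonneg_right hexp hC.le
      _ ≤ (Real.exp ((1 - ε) * m * (1 + Real.sqrt (d + 1))) * Real.exp (-((1 - ε) * m * N))) * (freePropRadial d (ε * m2) (Real.sqrt ε) + m2⁻¹) := by
          gcongr
          exact le_add_of_nonneg_right (inv_nonneg.mpr hm.le)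
      _ = _ := by ring
  · -- near blocks: the volume-free bound `S₂ ≤ m⁻²`
    have h0 := (kingS2Inf_pos_le hm z).2
    have hNn : 0 ≤ N := norm_nonneg _
    have hexp : (1 : ℝ) ≤ Real.exp ((1 - ε) * m * (1 + Real.sqrt (d + 1))) * Real.exp (-((1 - ε) * m * N)) := by
      rw [← Real.exp_add]
      exact Real.one_le_exp (by nlinarith [mul_nonneg h1ε hm'.le])
    calc kingS2Inf m2 z ≤ m2⁻¹ := h0
      _ ≤ (Real.exp ((1 - ε) * m * (1 + Real.sqrt (d + 1))) * Real.exp (-((1 - ε) * m * N))) * m2⁻¹ :=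
          le_mul_of_one_le_left (inv_nonneg.mpr hm.le) hexp
      _ ≤ (Real.exp ((1 - ε) * m * (1 + Real.sqrt (d + 1))) * Real.exp (-((1 - ε) * m * N))) * (freePropRadial d (ε * m2) (Real.sqrt ε) + m2⁻¹) := by
          gcongr
          exact le_add_of_nonneg_left hC.le
      _ = _ := by ring

/-- ★★ **LOWER, Euclidean**: for EVERY `z`, `S₂^{ℝ}(z) ≥ e^{−(√m²ρ + m²)}·(4π(ρ∕(2√m²)+1))^{−(d+1)∕2}` with `ρ = ‖z‖₂ + √(d+1) ≥ R₊(z)`.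
[cite: King1986, Thm 2.1 (2.22) p.654, Thm 3.3 (3.6) p.655] -/
theorem exp_le_kingS2Inf {m2 : ℝ} (hm : 0 < m2) (z : Fin (d + 1) → ℤ) :
    Real.exp (-(Real.sqrt m2 * (‖WithLp.toLp 2 (fun μ => (z μ : ℝ))‖ + Real.sqrt (d + 1)) + m2))
        * ((Real.sqrt (4 * Real.pi * ((‖WithLp.toLp 2 (fun μ => (z μ : ℝ))‖ + Real.sqrt (d + 1)) / (2 * Real.sqrt m2) + 1)))⁻¹) ^ (d + 1)
      ≤ kingS2Inf m2 z := by
  set ρ : ℝ := ‖WithLp.toLp 2 (fun μ => (z μ : ℝ))‖ + Real.sqrt (d + 1) with hρ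
  have hm' : 0 < Real.sqrt m2 := Real.sqrt_pos.mpr hm
  have hspan : blockSpan z ≤ ρ := blockSpan_le_norm_add z
  have hsp := blockSpan_pos z
  have hρ0 : 0 < ρ := hsp.trans_le hspan
  -- the bound is decreasing in the radius: pass from `ρ` to `R₊(z)` and use part Ϻ-c's lower comparison
  refine le_trans ?_ ((exp_mul_le_freePropRadial hm hsp).trans (freePropRadial_le_kingS2Inf hm z))
  refine mul_le_mul ?_ ?_ (pow_nonneg (inv_nonneg.mpr (Real.sqrt_nonneg _)) _) (Real.exp_nonneg _)
  · exact Real.exp_le_exp.mpr (by nlinarith)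
  · refine pow_le_pow_left₀ (inv_nonneg.mpr (Real.sqrt_nonneg _)) (inv_anti₀ (Real.sqrt_pos.mpr (by positivity)) (Real.sqrt_le_sqrt ?_)) _
    have : blockSpan z / (2 * Real.sqrt m2) ≤ ρ / (2 * Real.sqrt m2) := div_le_div_of_nonneg_right hspan (by positivity)
    nlinarith [Real.pi_pos]

/-! ## §3 The isotropic exact correlation length -/

/-- For every `M`, only finitely many `z ∈ ℤ^{d+1}` have `‖z‖₂ ≤ M`. [folklore] -/
theorem finite_norm_le (M : ℝ) : {z : Fin (d + 1) → ℤ | ‖WithLp.toLp 2 (fun μ => (z μ : ℝ))‖ ≤ M}.Finite := by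
  refine (Fintype.piFinset fun _ : Fin (d + 1) => Finset.Icc (-⌈M⌉) ⌈M⌉).finite_toSet.subset fun z hz => ?_
  rw [Finset.mem_coe, Fintype.mem_piFinset]
  intro μ
  rw [Finset.mem_Icc]
  have hμ : |(z μ : ℝ)| ≤ ‖WithLp.toLp 2 (fun μ => (z μ : ℝ))‖ := by
    rw [euclidNorm_eq, ← Real.sqrt_sq (abs_nonneg (z μ : ℝ)), sq_abs]
    exact Real.sqrt_le_sqrt (Finset.single_le_sum (f := fun ν => ((z ν : ℝ)) ^ 2) (fun ν _ => sq_nonneg _) (Finset.mem_univ μ))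
  have h : |(z μ : ℝ)| ≤ ⌈M⌉ := (hμ.trans hz).trans (Int.le_ceil M)
  rw [abs_le] at h
  constructor
  · exact_mod_cast h.1
  · exact_mod_cast h.2

/-- ★ `‖z‖₂ → ∞` along the cofinite filter of `ℤ^{d+1}`. [folklore] -/
theorem tendsto_euclidNorm_cofinite : Tendsto (fun z : Fin (d + 1) → ℤ => ‖WithLp.toLp 2 (fun μ => (z μ : ℝ))‖) cofinite atTop := by
  refine tendsto_atTop.2 fun M => ?_
  rw [eventually_cofinite]
  refine (finite_norm_le M).subset fun z hz => ?_
  simp only [mem_setOf_eq, not_le] at hz ⊢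
  exact hz.le

/-- `log(αx + β)∕x → 0` as `x → ∞` (`α > 0`). [folklore] -/
theorem tendsto_log_affine_div {α β : ℝ} (hα : 0 < α) : Tendsto (fun x : ℝ => Real.log (α * x + β) / x) atTop (𝓝 0) := by
  -- `log y / (α⁻¹ y − β/α) → 0` as `y → ∞`, composed with `y = αx + β → ∞`
  have h := Real.tendsto_pow_log_div_mul_add_atTop α⁻¹ (-(β / α)) 1 (inv_ne_zero hα.ne')
  have hy : Tendsto (fun x : ℝ => α * x + β) atTop atTop := tendsto_atTop_add_const_right _ β (tendsto_id.const_mul_atTop hα)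
  refine ((h.comp hy).congr' ?_)
  filter_upwards [eventually_gt_atTop 0] with x hx
  simp only [comp_apply, pow_one]
  congr 1
  field_simp
  ring

/-- ★★★ **THE ISOTROPIC EXACT CORRELATION LENGTH**: `log S₂^{ℝ}(z) ∕ ‖z‖₂ → −√m²` as `z → ∞` in `ℤ^{d+1}` (cofinite filter) — King's continuum block two-point function decays at
EXACTLY the rate `m` in the Euclidean distance, in every direction (parts Ϸ-j∕Ϸ-t: along lattice rays; part Ϸ-s: rate `m` in the sup-norm).
[cite: King1986, Thm 3.3 (3.6) p.655, Thm 2.1 (2.22) p.654] -/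
theorem tendsto_log_kingS2Inf_div_norm {m2 : ℝ} (hm : 0 < m2) :
    Tendsto (fun z : Fin (d + 1) → ℤ => Real.log (kingS2Inf m2 z) / ‖WithLp.toLp 2 (fun μ => (z μ : ℝ))‖) cofinite (𝓝 (-Real.sqrt m2)) := by
  set m : ℝ := Real.sqrt m2 with hmdef
  have hm' : 0 < m := Real.sqrt_pos.mpr hm
  set N : (Fin (d + 1) → ℤ) → ℝ := fun z => ‖WithLp.toLp 2 (fun μ => (z μ : ℝ))‖ with hN
  have hNtop : Tendsto N cofinite atTop := tendsto_euclidNorm_cofinite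
  have hNpos : ∀ᶠ z in cofinite, 0 < N z := hNtop.eventually (eventually_gt_atTop 0)
  rw [tendsto_order]
  constructor
  · -- lower: for `a < −m`, eventually `a < log S₂/N`
    intro a ha
    set c : ℝ := Real.sqrt (d + 1) with hc
    -- the lower bound `L(z) = [−(m(N+c)+m²) − ((d+1)/2)·log(4π((N+c)/(2m)+1))]/N → −m`
    have hL : Tendsto (fun z => (-(m * (N z + c) + m2) - ((d + 1 : ℝ) / 2) * Real.log (4 * Real.pi * ((N z + c) / (2 * m) + 1))) / N z) cofinite (𝓝 (-m)) := by
      have e : ∀ z, 0 < N z → (-(m * (N z + c) + m2) - ((d + 1 : ℝ) / 2) * Real.log (4 * Real.pi * ((N z + c) / (2 * m) + 1))) / N z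
          = -m + (-(m * c + m2)) / N z - ((d + 1 : ℝ) / 2) * (Real.log ((4 * Real.pi / (2 * m)) * N z + (4 * Real.pi * (c / (2 * m) + 1))) / N z) := by
        intro z hz
        have : 4 * Real.pi * ((N z + c) / (2 * m) + 1) = (4 * Real.pi / (2 * m)) * N z + (4 * Real.pi * (c / (2 * m) + 1)) := by
          field_simp
          ring
        rw [this]
        field_simp
        ring
      have h1 : Tendsto (fun z => (-(m * c + m2)) / N z) cofinite (𝓝 0) := tendsto_const_nhds.div_atTop hNtop
      have h2 : Tendsto (fun z => Real.log ((4 * Real.pi / (2 * m)) * N z + (4 * Real.pi * (c / (2 * m) + 1))) / N z) cofinite (𝓝 0) :=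
        (tendsto_log_affine_div (by positivity)).comp hNtop
      have h3 := (tendsto_const_nhds (x := -m)).add (h1.sub (h2.const_mul ((d + 1 : ℝ) / 2)))
      simp only [add_zero, mul_zero, sub_zero] at h3
      refine h3.congr' ?_
      filter_upwards [hNpos] with z hz
      rw [e z hz]
      ring
    filter_upwards [hL.eventually (lt_mem_nhds ha), hNpos] with z hz hNz
    refine lt_of_lt_of_le hz ?_
    rw [div_le_div_iff_of_pos_right hNz]
    have hlow := exp_le_kingS2Inf hm z
    have hpos : 0 < Real.exp (-(m * (N z + c) + m2)) * ((Real.sqrt (4 * Real.pi * ((N z + c) / (2 * m) + 1)))⁻¹) ^ (d + 1) := by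
      have : 0 < Real.sqrt (4 * Real.pi * ((N z + c) / (2 * m) + 1)) := Real.sqrt_pos.mpr (by positivity)
      positivity
    have hlog := Real.log_le_log hpos hlow
    refine le_trans (le_of_eq ?_) hlog
    have harg : 0 < 4 * Real.pi * ((N z + c) / (2 * m) + 1) := by positivity
    rw [Real.log_mul (Real.exp_pos _).ne' (pow_pos (inv_pos.mpr (Real.sqrt_pos.mpr harg)) _).ne', Real.log_exp, Real.log_pow, Real.log_inv,
      Real.log_sqrt harg.le]
    push_cast
    ring
  · -- upper: for `b > −m`, eventually `log S₂/N < b`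
    intro b hb
    -- choose `ε ∈ (0,1]` with `−(1−ε)m < b`
    set ε : ℝ := min 1 ((b + m) / (2 * m)) with hε
    have hbm : 0 < b + m := by linarith
    have hε0 : 0 < ε := lt_min one_pos (div_pos hbm (by positivity))
    have hε1 : ε ≤ 1 := min_le_left _ _
    have hεb : -((1 - ε) * m) < b := by
      have : ε ≤ (b + m) / (2 * m) := min_le_right _ _
      have h2 : ε * m ≤ (b + m) / 2 := by
        have := mul_le_mul_of_nonneg_right this hm'.le
        calc ε * m ≤ (b + m) / (2 * m) * m := this
          _ = (b + m) / 2 := by field_simp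
      nlinarith
    set K : ℝ := Real.exp ((1 - ε) * m * (1 + Real.sqrt (d + 1))) * (freePropRadial d (ε * m2) (Real.sqrt ε) + m2⁻¹) with hK
    have hKpos : 0 < K := by
      have := freePropRadial_pos (d := d) (mul_pos hε0 hm) (Real.sqrt_pos.mpr hε0)
      positivity
    have hU : Tendsto (fun z => Real.log K / N z - (1 - ε) * m) cofinite (𝓝 (-((1 - ε) * m))) := by
      have h1 : Tendsto (fun z => Real.log K / N z) cofinite (𝓝 0) := tendsto_const_nhds.div_atTop hNtop
      have := h1.sub (tendsto_const_nhds (x := (1 - ε) * m))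
      simpa using this
    filter_upwards [hU.eventually (gt_mem_nhds hεb), hNpos] with z hz hNz
    refine lt_of_le_of_lt ?_ hz
    have hup := kingS2Inf_le_const_mul_exp_neg_norm hm hε0 hε1 z
    have hlog := Real.log_le_log (kingS2Inf_pos hm z) hup
    rw [Real.log_mul hKpos.ne' (Real.exp_pos _).ne', Real.log_exp] at hlog
    rw [div_le_iff₀ hNz]
    have : (Real.log K / N z - (1 - ε) * m) * N z = Real.log K - (1 - ε) * m * N z := by field_simp
    rw [this]
    linarith

end Summit.QuantumFields.YangMills.BalabanUVNodes.N15KingModelRung.ProperTime
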